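import Literature.NumberTheory.NumberFields.SplitPrimesDisjointnessAbsolute
import Literature.NumberTheory.GaloisRepresentations.DecomposedGenericRestrict
import Literature.NumberTheory.GaloisRepresentations.EnormousSubgroup
import HarnessLib

/-!
# The residual hypotheses of ACC+ Thm. 6.1.1 pass to `V`-split extensions

Topic `NumberTheory/GaloisRepresentations`.  Theorem-only file (no definition, no named fact,
D-0026) assembling, in the exact vocabulary of the tree's statement of the Fontaine–Laffaille
automorphy lifting theorem of Allen–Calegari–Caraiani–Gee–Helm–Le Hung–Newton–Scholze–Taylor–
Thorne (`Automorphic/ACCAutomorphyLiftingCrystalline.lean`,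
`ACCGHLNSTT2023.automorphyLifting_crystalline_weightZero`: hypotheses (3)–(4) on a residual
representation `τ = ρ̄ : Γ_F →* GL_n(k)` — `IsAbsIrreducible τ`, `IsDecomposedGeneric τ`,
`IsAbsIrreducible (τ.comp Γ_{F(ζ_p)}.subtype)`, `Subgroup.IsEnormous (Γ_{F(ζ_p)}.map τ)`, a scalar
`τ σ` with `σ ∉ Γ_{F(ζ_p)} = absGaloisGroupAdjoinRootsOfUnity F p`), the step of the printed proof
(Ann. of Math. 197 (2023), §6.5.12; arXiv:1812.09999 p. 88) in which these hypotheses are moved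
from `F` to the auxiliary soluble CM extension `E/F`:

> If `E/F` is any finite Galois extension which is `V₀ ∪ V₁ ∪ V₂`-split, then `ρ̄|_{G_E}` has
> the following properties: `ρ̄(G_E) = ρ̄(G_F)` and `ρ̄(G_{E(ζ_p)}) = ρ̄(G_{F(ζ_p)})`. In particular,
> `ρ̄|_{G_{E(ζ_p)}}` has enormous image and there exists `σ ∈ G_E − G_{E(ζ_p)}` such that `ρ̄(σ)`
> is a scalar. `ρ̄|_{G_E}` is decomposed generic. Indeed, the rational prime `p₀` splits in `E`.

from the tree's bricks `NumberFields/SplitPrimesDisjointnessAbsolute.lean` (the finite set `V`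
and `Γ_E · (ker ρ̄ ∩ Γ_{F(ζ_p)}) = Γ_F` for `V`-split `E`) and
`GaloisRepresentations/DecomposedGenericRestrict.lean` (decomposed generic primes under
restriction), with `ρ̄|_{Γ_E} = ρ̄ ∘ res`, `res = absGaloisRestrict F E : Γ_E → Γ_F`:

* `IsAbsIrreducible.comp_of_range_le` — `σ ∘ φ` is absolutely irreducible when `σ` is and
  `σ(φ(Γ')) ⊇ σ(Γ)` (absolute irreducibility depends only on the image; the tree's
  `isIrreducible_glRepresentation_of_range_le` after every scalar extension `GL_n(f)`; cf. the
  monotone form `IsAbsIrreducible.of_range_le` in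
  `Automorphic/CaraianiNewtonResidualImageModularity.lean`, not imported here).
* `exists_finset_forall_splitPrimes_residual_hypotheses` — **for every finite extension `E/F` in
  which the places of `V` split completely, each of the hypotheses (3)–(4) for `τ` implies the
  same hypothesis for `τ ∘ res`** (decomposed genericity: for a decomposed generic prime `p₀` that
  splits completely in `E` — in print `E` is also `V₂`-split, `V₂` the `p₀`-adic places).

## References

* [ACCGHLNSTT2023] P. B. Allen et al., *Potential automorphy over CM fields*, Ann. of Math. (2)
  197 (2023), 897–1113, §6.5.12 (proof of Thm. 6.1.1), arXiv:1812.09999 p. 88.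
-/

noncomputable section

open NumberField IsDedekindDomain Field

open scoped MatrixGroups Classical

namespace Literature.NumberTheory.GaloisRepresentations

universe w

/-! ### Absolute irreducibility depends only on the image -/

section AbsIrreducible

variable {Γ : Type*} [Group Γ] {Γ' : Type*} [Group Γ'] {k : Type w} [Field k] {n : ℕ}

/-- Absolute irreducibility only depends on the image: if `τ : Γ' →* GL_n(k)` is absolutely
irreducible and `τ(Γ') ⊆ σ(Γ)` then `σ : Γ →* GL_n(k)` is absolutely irreducible.  (Local copy of
`IsAbsIrreducible.of_range_le` of `Automorphic/CaraianiNewtonResidualImageModularity.lean`, whose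
import closure — `Mathlib` and the modularity files — is not wanted here; proved from the tree's
`isIrreducible_glRepresentation_of_range_le` after every scalar extension `GL_n(f)`.)
[folklore] -/
private theorem isAbsIrreducible_of_range_le_aux {τ : Γ' →* GL (Fin n) k} {σ : Γ →* GL (Fin n) k}
    (hτ : IsAbsIrreducible τ) (h : τ.range ≤ σ.range) : IsAbsIrreducible σ := by
  intro k' _ f
  refine isIrreducible_glRepresentation_of_range_le (hτ k' f) ?_
  rw [MonoidHom.range_comp, MonoidHom.range_comp]
  exact Subgroup.map_mono h

/-- **`σ ∘ φ` is absolutely irreducible as soon as `σ` is and `σ(φ(Γ')) ⊇ σ(Γ)`** (absolute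
irreducibility only depends on the image subgroup: after any extension of scalars
`f : k →+* k'`, a `σ(φ(Γ'))`-stable subspace of `k'ⁿ` is `σ(Γ)`-stable; Curtis–Reiner, *Methods*
I, §3B).  The form in which restriction to `Γ_E` along `res : Γ_E → Γ_F` with
`ρ̄(res Γ_E) = ρ̄(Γ_F)` preserves absolute irreducibility. [folklore] -/
theorem IsAbsIrreducible.comp_of_range_le {σ : Γ →* GL (Fin n) k} (hσ : IsAbsIrreducible σ)
    (φ : Γ' →* Γ) (h : σ.range ≤ (σ.comp φ).range) : IsAbsIrreducible (σ.comp φ) :=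
  isAbsIrreducible_of_range_le_aux hσ h

end AbsIrreducible

/-! ### The transfer -/

section Transfer

variable {F : Type} [Field F] [NumberField F] {k : Type w} [Field k] {n : ℕ}

/-- **The residual hypotheses (3)–(4) of ACC+ Thm. 6.1.1 pass to `V`-split extensions.**  Let
`τ = ρ̄ : Γ_F →* GL_n(k)` have open kernel (e.g. a residual representation of a continuous
`p`-adic `ρ`, `FramedGaloisRep.isOpen_ker_of_isResidualRepOf`), `p` a prime, `S` a finite set of
finite places of `F`.  There is a finite set `V` of finite places of `F` outside `S`, of prime
absolute norm, with `ρ̄(I_𝔓) = 1` and `I_𝔓 ≤ Γ_{F(ζ_p)}` above `V`, such that for EVERY finite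
extension `E/F` (an `F`-algebra, Galois or not) in which all places of `V` split completely, with
`ρ̄|_{Γ_E} = ρ̄ ∘ res` (`res = absGaloisRestrict F E`): (a) `ρ̄` absolutely irreducible ⟹
`ρ̄|_{Γ_E}` absolutely irreducible; (b) a decomposed generic prime `p₀` of `ρ̄` that splits
completely in `E` is decomposed generic for `ρ̄|_{Γ_E}`; (c) `ρ̄|_{Γ_{F(ζ_p)}}` absolutely
irreducible ⟹ `ρ̄|_{Γ_{E(ζ_p)}}` absolutely irreducible; (d) `ρ̄(Γ_{E(ζ_p)}) = ρ̄(Γ_{F(ζ_p)})`, so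
(e) enormousness of the image passes over; (f) a scalar `ρ̄(σ)`, `σ ∈ Γ_F ∖ Γ_{F(ζ_p)}`, yields a
scalar `ρ̄(σ')`, `σ' ∈ Γ_E ∖ Γ_{E(ζ_p)}`.  Printed: "`ρ̄(G_E) = ρ̄(G_F)` and
`ρ̄(G_{E(ζ_p)}) = ρ̄(G_{F(ζ_p)})`. In particular, `ρ̄|_{G_{E(ζ_p)}}` has enormous image and there
exists `σ ∈ G_E − G_{E(ζ_p)}` such that `ρ̄(σ)` is a scalar. `ρ̄|_{G_E}` is decomposed generic.
Indeed, the rational prime `p₀` splits in `E`."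
[cite: ACCGHLNSTT2023, §6.5.12 (proof of Thm. 6.1.1, p. 88 of arXiv:1812.09999)] -/
theorem exists_finset_forall_splitPrimes_residual_hypotheses
    (τ : absoluteGaloisGroup F →* GL (Fin n) k) (hτ : IsOpen (τ.ker : Set (absoluteGaloisGroup F)))
    (p : ℕ) [Fact p.Prime] (S : Set (HeightOneSpectrum (𝓞 F))) (hS : S.Finite) :
    ∃ V : Finset (HeightOneSpectrum (𝓞 F)),
      (∀ q ∈ V, q ∉ S ∧ (Ideal.absNorm q.asIdeal).Prime ∧
        ∀ 𝔓 ∈ q.primesAbove, ∀ γ ∈ 𝔓.inertia (absoluteGaloisGroup F),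
          τ γ = 1 ∧ γ ∈ absGaloisGroupAdjoinRootsOfUnity F p) ∧
      ∀ (E : Type) [Field E] [NumberField E] [Algebra F E],
        (∀ q ∈ V, q ∈ splitPrimes F E) →
        -- (a) absolute irreducibility
        (IsAbsIrreducible τ → IsAbsIrreducible (τ.comp (absGaloisRestrict F E).toMonoidHom)) ∧
        -- (b) decomposed generic primes splitting completely in `E`
        (∀ p₀ : ℕ, IsDecomposedGenericPrime τ p₀ → SplitsCompletely E p₀ →
          IsDecomposedGenericPrime (τ.comp (absGaloisRestrict F E).toMonoidHom) p₀) ∧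
        -- (c) absolute irreducibility on `Γ_{·(ζ_p)}`
        (IsAbsIrreducible (τ.comp (absGaloisGroupAdjoinRootsOfUnity F p).subtype) →
          IsAbsIrreducible ((τ.comp (absGaloisRestrict F E).toMonoidHom).comp
            (absGaloisGroupAdjoinRootsOfUnity E p).subtype)) ∧
        -- (d) `ρ̄(Γ_{E(ζ_p)}) = ρ̄(Γ_{F(ζ_p)})`
        (absGaloisGroupAdjoinRootsOfUnity E p).map (τ.comp (absGaloisRestrict F E).toMonoidHom) =
          (absGaloisGroupAdjoinRootsOfUnity F p).map τ ∧
        -- (e) enormous image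
        (Subgroup.IsEnormous ((absGaloisGroupAdjoinRootsOfUnity F p).map τ) →
          Subgroup.IsEnormous ((absGaloisGroupAdjoinRootsOfUnity E p).map
            (τ.comp (absGaloisRestrict F E).toMonoidHom))) ∧
        -- (f) a scalar off `Γ_{·(ζ_p)}`
        ((∃ σ : absoluteGaloisGroup F, σ ∉ absGaloisGroupAdjoinRootsOfUnity F p ∧
            ∃ c : k, ((τ σ : GL (Fin n) k) : Matrix (Fin n) (Fin n) k) = c • (1 : Matrix _ _ _)) →
          ∃ σ' : absoluteGaloisGroup E, σ' ∉ absGaloisGroupAdjoinRootsOfUnity E p ∧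
            ∃ c : k, (((τ.comp (absGaloisRestrict F E).toMonoidHom) σ' : GL (Fin n) k) :
              Matrix (Fin n) (Fin n) k) = c • (1 : Matrix _ _ _)) := by
  obtain ⟨V, hV, hV'⟩ :=
    NumberFields.exists_finset_forall_splitPrimes_residual_hypotheses_transfer τ hτ p S hS
  refine ⟨V, hV, fun E _ _ _ hE => ?_⟩
  obtain ⟨hrange, hC, hσ⟩ := hV' E hE
  refine ⟨fun habs => habs.comp_of_range_le _ hrange.ge,
    fun p₀ hp₀ hE₀ => hp₀.comp_absGaloisRestrict hE₀,
    fun habs => isAbsIrreducible_of_range_le_aux habs ?_, hC, fun henorm => ?_, ?_⟩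
  · -- `ρ̄(Γ_{F(ζ_p)}) ≤ (ρ̄ ∘ res)(Γ_{E(ζ_p)})`
    rw [MonoidHom.range_comp, MonoidHom.range_comp, Subgroup.range_subtype, Subgroup.range_subtype,
      hC]
  · rwa [hC]
  · rintro ⟨σ, hσC, c, hc⟩
    obtain ⟨σ', hσ'eq, hσ'C⟩ := hσ σ
    refine ⟨σ', fun h => hσC (hσ'C.mp h), c, ?_⟩
    rw [← hc, ← hσ'eq]
    rfl

end Transfer

end Literature.NumberTheory.GaloisRepresentations

end
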